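import Summits.CriticalPhenomena.PercolationContinuityZ3.Theorems.PercNearOneGluingNoHeavyQuantWindowPairMix
import Summits.CriticalPhenomena.PercolationContinuityZ3.Theorems.PercNearOneGluingNoHeavyQuantWindowPairPoly
import HarnessLib

/-!
# QUANT lane R8, T-DEC: the window pair with transfer (`LawDec.SliceLawSW`, MID case `T + ag ≤ 2h`, `h′ = h`) — part 3:
# the DEEP cells D-A / D-B / D-C (the shifted low copy `l + a` is still low: `2(l+a) < T + ag`)

builds on p205010 (kernel theorem, internal audit signed; external expert review pending)

Support file (`--supports stmt-CriticalPhenomena-4575`), QUANT lane seat prim-quant-census-1 (gen 20), rung R8 of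
`run/shared/lean/prim/quant/LADDER.md`.  Theorems only, standard axioms, no sorries.  Memo
`run/shared/lean/prim/quant/prim-quant-census-1/SLICELAWSW-G20.md` §2–§3.

SETTING (light window pair, MID): floor `0 < x < 1`, blob `(a, g)` with `x ≤ g < 1`, `a ≥ 1`; low `l` (`2l < T`), window absorber `h`
(`T < l + h`, `h ≤ j′ < h + a`, `h ≤ M`), `l + a ≤ j′`; LIGHT: `T − 2l < x(h − l)` (so `γ = x² + (1−x)ρ`, `ρ = (T−2l)/(h−l)`);
MID: `T + ag ≤ 2h`.  The law to decompose at target `T′ = T + ag`, layer `j′`, on `{0..M+a}` is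
`(1−γ)(1−g)·δ_l + (1−γ)g·δ_{l+a} + (γ(1−g) + t(1−g))·δ_h + (γg − t(1−g))·δ_{h+a}` for SOME transfer `0 ≤ t(1−g) ≤ γg`.
DEEP (`2(l+a) < T′`): the shifted low copy is shipped ENTIRELY into `h` through the (always light, always compatible) credit pair
`(l+a, h)` at its minimal gate `γ₁`; the row-0 low `l` goes
* D-A (`T′ − 2l < x(h−l)`, row-0 pair light): entirely into `h` at `γ₀`; `t = t_max = γg/(1−g)` (all giant mass moved down);
* D-B (row-0 pair not light, `(1−γ)(1−g)·x ≤ γg(1−x)`): entirely into the giant `h + a` at gate `x`; `t(1−g) = γg − (1−γ)(1−g)x/(1−x)`;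
* D-C (row-0 pair heavy and compatible, `(1−γ)(1−g)x > γg(1−x)`): the giant is filled (`γg(1−x)/x` of `l`), the rest of `l` into `h` at
  the heavy gate `ρ₀`; `t = 0`;
and the incompatible row-0 pair forces the D-B side condition (`poly_DX`).  In the coordinates `p = 1 + x − ρ`, `w = ag/(h−l)` the point
weight left at `h` is `poly_DA / poly_DB / poly_DC ≥ 0` (`…QuantWindowPairPoly`) over a positive denominator.

* `LawDec.windowPair_coords` — the coordinates and their basic facts.
* `LawDec.windowPair_deep_gate₁` — the pair `(l+a, h)` at `T′`: compatible, light, `1/(1−γ₁)` in closed form.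
* **`LawDec.windowPair_deep_A / _B / _C`** — the three cells (their union `windowPair_deep` and the emptiness lemma `windowPair_deep_X` are in part 5).

[this work].  Nothing here is cited as a published result.  The gluing rows served [cite: KozmaNitzan2024, Conjecture 3 (p. 15)];
product measure [cite: Grimmett1999, §1.3 p. 10].
-/

noncomputable section

namespace Summit.CriticalPhenomena.PercolationContinuityZ3.Theorems

namespace Quant

open Finset

namespace LawDec

/-! ### Coordinates -/

/-- **the coordinates `p`, `w` of a light window pair** and their basic facts: `p = 1 + x − ρ ∈ (1, 1+x)`, `w = ag/(h−l) > 0`,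
`γ = x² + (1−x)ρ = 1 − (1−x)p`, `ρ₀ = (T + ag − 2l)/(h−l) = 1 + x − p + w`. [this work] -/
theorem windowPair_coords (x g T : ℝ) (l a h : ℕ) (hx1 : x < 1) (hg0 : 0 < g) (ha : 1 ≤ a)
    (hlow : 2 * (l : ℝ) < T) (hcomp : T < (l : ℝ) + h) (hlight : T - 2 * (l : ℝ) < x * ((h : ℝ) - l)) :
    ∃ p w : ℝ, p = 1 + x - (T - 2 * (l : ℝ)) / ((h : ℝ) - l) ∧ w = (a : ℝ) * g / ((h : ℝ) - l) ∧ 1 < p ∧ p < 1 + x ∧ 0 < w ∧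
      0 < (h : ℝ) - l ∧ x ^ 2 + (1 - x) * ((T - 2 * (l : ℝ)) / ((h : ℝ) - l)) = 1 - (1 - x) * p ∧
      (T + (a : ℝ) * g - 2 * (l : ℝ)) / ((h : ℝ) - l) = 1 + x - p + w ∧ 0 < 1 - (1 - x) * p := by
  have hD : 0 < (h : ℝ) - l := by linarith
  have ha0 : (0 : ℝ) < a := by exact_mod_cast Nat.lt_of_lt_of_le Nat.zero_lt_one ha
  have hρ0 : 0 < (T - 2 * (l : ℝ)) / ((h : ℝ) - l) := div_pos (by linarith) hD
  have hρx : (T - 2 * (l : ℝ)) / ((h : ℝ) - l) < x := by rw [div_lt_iff₀ hD]; linarith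
  refine ⟨1 + x - (T - 2 * (l : ℝ)) / ((h : ℝ) - l), (a : ℝ) * g / ((h : ℝ) - l), rfl, rfl, by linarith, by linarith,
    div_pos (mul_pos ha0 hg0) hD, hD, by ring, ?_, ?_⟩
  · field_simp; ring
  · nlinarith [mul_pos (sub_pos.2 hx1) hρ0, sq_nonneg x]

/-- **the deep pair `(l+a, h)` at the new target**: if `2(l+a) < T + ag` (deep) then `l + a < h`, the pair is compatible, its
`ρ₁ = (T + ag − 2(l+a))/(h − l − a)` lies in `(0, x)` (LIGHT), and with `γ₁ = x² + (1−x)ρ₁`: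
`1 − γ₁ = (1−x)(pg + w(1−x−g))/(g − w)` with `g − w > 0`, `pg + w(1−x−g) > 0`. [this work] -/
theorem windowPair_deep_gate₁ (x g T p w : ℝ) (l a h : ℕ) (hx0 : 0 < x) (hx1 : x < 1) (hxg : x ≤ g) (hg1 : g < 1)
    (hlow : 2 * (l : ℝ) < T) (hcomp : T < (l : ℝ) + h) (hlight : T - 2 * (l : ℝ) < x * ((h : ℝ) - l))
    (hdeep : 2 * ((l : ℝ) + a) < T + (a : ℝ) * g)
    (hp : p = 1 + x - (T - 2 * (l : ℝ)) / ((h : ℝ) - l)) (hw : w = (a : ℝ) * g / ((h : ℝ) - l)) :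
    (l : ℝ) + a < h ∧ 0 < (h : ℝ) - l - a ∧ 0 < g - w ∧ 0 < p * g + w * (1 - x - g) ∧
      0 < (T + (a : ℝ) * g - 2 * ((l : ℝ) + a)) / ((h : ℝ) - l - a) ∧
      (T + (a : ℝ) * g - 2 * ((l : ℝ) + a)) / ((h : ℝ) - l - a) < x ∧
      1 - (x ^ 2 + (1 - x) * ((T + (a : ℝ) * g - 2 * ((l : ℝ) + a)) / ((h : ℝ) - l - a)))
        = (1 - x) * (p * g + w * (1 - x - g)) / (g - w) ∧
      0 < g * (1 + x - p) - w * (2 - g) := by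
  have hD : 0 < (h : ℝ) - l := by linarith
  have hg0 : 0 < g := lt_of_lt_of_le hx0 hxg
  -- a < h - l : from 2a < (T - 2l) + a g < x (h - l) + a g < (h - l) + a
  have haD : (a : ℝ) < (h : ℝ) - l := by nlinarith
  have hDa : 0 < (h : ℝ) - l - a := by linarith
  have hgw : 0 < g - w := by
    rw [hw, sub_pos, div_lt_iff₀ hD]; nlinarith
  have hρ₁0 : 0 < (T + (a : ℝ) * g - 2 * ((l : ℝ) + a)) / ((h : ℝ) - l - a) := div_pos (by linarith) hDa
  have hρ₁x : (T + (a : ℝ) * g - 2 * ((l : ℝ) + a)) / ((h : ℝ) - l - a) < x := by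
    rw [div_lt_iff₀ hDa]; nlinarith
  have hden : 0 < p * g + w * (1 - x - g) := by
    -- (1 - γ₁)(g - w) = (1-x)(pg + w(1-x-g)) with 1 - γ₁ > 0
    have e : p * g + w * (1 - x - g) = (g - w) * (1 + x - (T + (a : ℝ) * g - 2 * ((l : ℝ) + a)) / ((h : ℝ) - l - a)) := by
      rw [hp, hw]; field_simp; ring
    rw [e]; exact mul_pos hgw (by linarith)
  refine ⟨by linarith, hDa, hgw, hden, hρ₁0, hρ₁x, ?_, ?_⟩
  · rw [hp, hw]; field_simp; ring
  · rw [hp, hw]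
    have e : g * (1 + x - (1 + x - (T - 2 * (l : ℝ)) / ((h : ℝ) - l))) - (a : ℝ) * g / ((h : ℝ) - l) * (2 - g)
        = g * ((T - 2 * (l : ℝ)) + (a : ℝ) * g - 2 * (a : ℝ)) / ((h : ℝ) - l) := by
      field_simp; ring
    rw [e]; exact div_pos (mul_pos hg0 (by linarith)) hD

/-! ### The three deep cells -/

set_option maxHeartbeats 800000 in
/-- **cell D-A** (deep, row-0 pair light `T + ag − 2l < x(h−l)`): both low copies go into `h`, all giant mass is moved down
(`t = γg/(1−g)`); the point weight left at `h` is `poly_DA/((pg + w(1−x−g))(p − w)) ≥ 0`. [this work] -/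
theorem windowPair_deep_A (x g T γ : ℝ) (j' M l a h : ℕ) (hx0 : 0 < x) (hx1 : x < 1) (hxg : x ≤ g) (hg1 : g < 1) (ha : 1 ≤ a)
    (hlaj : l + a ≤ j') (hlow : 2 * (l : ℝ) < T) (hjha : j' + 1 ≤ h + a) (hhj : h ≤ j') (hhM : h ≤ M) (hcomp : T < (l : ℝ) + h)
    (hlight : T - 2 * (l : ℝ) < x * ((h : ℝ) - l)) (hmid : T + (a : ℝ) * g ≤ 2 * (h : ℝ))
    (hγ : γ = x ^ 2 + (1 - x) * ((T - 2 * (l : ℝ)) / ((h : ℝ) - l)))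
    (hdeep : 2 * ((l : ℝ) + a) < T + (a : ℝ) * g) (hlight0 : T + (a : ℝ) * g - 2 * (l : ℝ) < x * ((h : ℝ) - l)) :
    ∃ t : ℝ, 0 ≤ t ∧ t * (1 - g) ≤ γ * g ∧
      DECAtT x (T + (a : ℝ) * g) j' (M + a) (fun k => (1 - γ) * (1 - g) * (if k = l then (1 : ℝ) else 0)
        + (1 - γ) * g * (if k = l + a then (1 : ℝ) else 0) + (γ * (1 - g) + t * (1 - g)) * (if k = h then (1 : ℝ) else 0)
        + (γ * g - t * (1 - g)) * (if k = h + a then (1 : ℝ) else 0)) := by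
  have hg0 : 0 < g := lt_of_lt_of_le hx0 hxg
  obtain ⟨p, w, hp, hw, hp1, hpx, hw0, hD, hγp, hρ₀, hγpos⟩ := windowPair_coords x g T l a h hx1 hg0 ha hlow hcomp hlight
  obtain ⟨hlah, hDa, hgw, hden, hρ₁0, hρ₁x, h1γ₁, hdeep'⟩ :=
    windowPair_deep_gate₁ x g T p w l a h hx0 hx1 hxg hg1 hlow hcomp hlight hdeep hp hw
  rw [hγp] at hγ
  have hx1ne : (1 - x) ≠ 0 := ne_of_gt (by linarith)
  have hg1ne : (1 - g) ≠ 0 := ne_of_gt (by linarith)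
  have hxne : x ≠ 0 := ne_of_gt hx0
  -- the two gates
  set ρ₁ : ℝ := (T + (a : ℝ) * g - 2 * ((l : ℝ) + a)) / ((h : ℝ) - l - a) with hρ₁
  set γ₁ : ℝ := x ^ 2 + (1 - x) * ρ₁ with hγ₁
  set ρ₀ : ℝ := (T + (a : ℝ) * g - 2 * (l : ℝ)) / ((h : ℝ) - l) with hρ₀d
  set γ₀ : ℝ := x ^ 2 + (1 - x) * ρ₀ with hγ₀
  have hρ₀x : ρ₀ < x := by rw [hρ₀d, div_lt_iff₀ hD]; linarith
  have hρ₀0 : 0 < ρ₀ := by rw [hρ₀d]; exact div_pos (by linarith) hD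
  have hγ₁x : γ₁ < x := by rw [hγ₁]; nlinarith [mul_lt_mul_of_pos_left hρ₁x (sub_pos.2 hx1)]
  have hγ₁0 : 0 ≤ γ₁ := by rw [hγ₁]; nlinarith [mul_nonneg (sub_nonneg.2 hx1.le) hρ₁0.le, sq_nonneg x]
  have hγ₀x : γ₀ < x := by rw [hγ₀]; nlinarith [mul_lt_mul_of_pos_left hρ₀x (sub_pos.2 hx1)]
  have hγ₀0 : 0 ≤ γ₀ := by rw [hγ₀]; nlinarith [mul_nonneg (sub_nonneg.2 hx1.le) hρ₀0.le, sq_nonneg x]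
  have h1γ₀ : 1 - γ₀ = (1 - x) * (p - w) := by rw [hγ₀, hρ₀]; ring
  have hpw : 0 < p - w := by linarith
  have h1γ₁pos : 0 < 1 - γ₁ := by linarith
  have h1γ₀pos : 0 < 1 - γ₀ := by linarith
  -- weights (closed forms) and balances
  set lam₁ : ℝ := p * g * (g - w) / (p * g + w * (1 - x - g)) with hlam₁
  set lam₀ : ℝ := p * (1 - g) / (p - w) with hlam₀
  have hlam₁0 : 0 ≤ lam₁ := div_nonneg (mul_nonneg (mul_nonneg (by linarith) hg0.le) hgw.le) hden.le
  have hlam₀0 : 0 ≤ lam₀ := div_nonneg (mul_nonneg (by linarith) (by linarith)) hpw.le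
  have hbal₁ : lam₁ * (1 - γ₁) = (1 - γ) * g := by
    rw [hlam₁, h1γ₁, hγ]; field_simp; ring
  have hbal₀ : lam₀ * (1 - γ₀) = (1 - γ) * (1 - g) := by
    rw [hlam₀, h1γ₀, hγ]; field_simp; ring
  -- the point weight at h: lam₁ + lam₀ ≤ 1  (poly_DA)
  have key := WindowPairCert.poly_DA x g p w (by linarith) hg0.le (by linarith) (by linarith) (by linarith) (by linarith)
    (by linarith) hw0.le (by linarith [hdeep']) (by linarith) (by linarith)
  have hsum : lam₁ + lam₀ ≤ 1 := by
    rw [hlam₁, hlam₀, div_add_div _ _ hden.ne' hpw.ne', div_le_one (mul_pos hden hpw)]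
    nlinarith [key]
  have hπ : 0 ≤ γ * (1 - g) + γ * g - lam₁ * γ₁ - lam₀ * γ₀ := by nlinarith [hbal₁, hbal₀, hsum]
  have ht : γ * g / (1 - g) * (1 - g) = γ * g := div_mul_cancel₀ _ (by linarith)
  refine ⟨γ * g / (1 - g), div_nonneg (mul_nonneg (by rw [hγ]; nlinarith) hg0.le) (by linarith), by rw [ht], ?_⟩
  simp only [ht]
  · refine windowPair_decAtT_of_weights x (T + (a : ℝ) * g) j' (M + a) l a h
      ((1 - γ) * (1 - g)) ((1 - γ) * g) (γ * (1 - g) + γ * g) (γ * g - γ * g)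
      γ₁ 0 γ₀ lam₁ 0 lam₀ 0 0 (γ * (1 - g) + γ * g - lam₁ * γ₁ - lam₀ * γ₀) 0
      hx0.le hx1.le ha (by exact_mod_cast (show (l : ℝ) < h by linarith)) hlaj hhj hjha (by omega) hmid
      ⟨hγ₁0, by linarith⟩ ⟨le_rfl, zero_le_one⟩ ⟨hγ₀0, by linarith⟩ hlam₁0 le_rfl hlam₀0 le_rfl le_rfl hπ le_rfl
      ?_ ?_ ?_ ?_ ?_ ?_ ?_ ?_ ?_
    · -- balance at l
      linear_combination hbal₀
    · -- balance at l + a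
      linear_combination hbal₁
    · -- balance at h
      ring
    · -- balance at h + a
      ring
    · -- total mass
      ring
    · -- validity of (l+a, h): light credit pair, credit exactly T'
      intro _
      refine ⟨by exact_mod_cast hlah, ?_⟩
      rw [if_neg (not_le.2 hγ₁x)]
      have e : (γ₁ - x ^ 2) / (1 - x) = ρ₁ := by
        rw [hγ₁, add_sub_cancel_left, mul_div_cancel_left₀ _ (by linarith : (1 - x) ≠ 0)]
      rw [e, hρ₁]
      have hne : ((h : ℝ) - ((l + a : ℕ) : ℝ)) ≠ 0 := by push_cast; linarith
      push_cast
      rw [show (h : ℝ) - ((l : ℝ) + a) = (h : ℝ) - l - a by ring, mul_div_cancel₀ _ hDa.ne']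
      linarith
    · intro h0; exact absurd h0 (lt_irrefl 0)
    · -- validity of (l, h): light credit pair, credit exactly T'
      intro _
      rw [if_neg (not_le.2 hγ₀x)]
      have e : (γ₀ - x ^ 2) / (1 - x) = ρ₀ := by
        rw [hγ₀, add_sub_cancel_left, mul_div_cancel_left₀ _ (by linarith : (1 - x) ≠ 0)]
      rw [e, hρ₀d, mul_div_cancel₀ _ hD.ne']
      linarith
    · intro h0; exact absurd h0 (lt_irrefl 0)

set_option maxHeartbeats 800000 in
/-- **cell D-B** (deep, row-0 pair NOT light `x(h−l) ≤ T + ag − 2l`, and the giant can take the row-0 low: `(1−γ)(1−g)x ≤ γg(1−x)`):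
`l + a ↦ h` (light credit pair), `l ↦ h + a` (giant pair at gate `x`), `t(1−g) = γg − (1−γ)(1−g)x/(1−x)`; the point weight left at `h`
is `poly_DB/(pg + w(1−x−g)) ≥ 0`. [this work] -/
theorem windowPair_deep_B (x g T γ : ℝ) (j' M l a h : ℕ) (hx0 : 0 < x) (hx1 : x < 1) (hxg : x ≤ g) (hg1 : g < 1) (ha : 1 ≤ a)
    (hlaj : l + a ≤ j') (hlow : 2 * (l : ℝ) < T) (hjha : j' + 1 ≤ h + a) (hhj : h ≤ j') (hhM : h ≤ M) (hcomp : T < (l : ℝ) + h)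
    (hlight : T - 2 * (l : ℝ) < x * ((h : ℝ) - l)) (hmid : T + (a : ℝ) * g ≤ 2 * (h : ℝ))
    (hγ : γ = x ^ 2 + (1 - x) * ((T - 2 * (l : ℝ)) / ((h : ℝ) - l)))
    (hdeep : 2 * ((l : ℝ) + a) < T + (a : ℝ) * g) (hheavy0 : x * ((h : ℝ) - l) ≤ T + (a : ℝ) * g - 2 * (l : ℝ))
    (hside : (1 - γ) * (1 - g) * x ≤ γ * g * (1 - x)) :
    ∃ t : ℝ, 0 ≤ t ∧ t * (1 - g) ≤ γ * g ∧
      DECAtT x (T + (a : ℝ) * g) j' (M + a) (fun k => (1 - γ) * (1 - g) * (if k = l then (1 : ℝ) else 0)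
        + (1 - γ) * g * (if k = l + a then (1 : ℝ) else 0) + (γ * (1 - g) + t * (1 - g)) * (if k = h then (1 : ℝ) else 0)
        + (γ * g - t * (1 - g)) * (if k = h + a then (1 : ℝ) else 0)) := by
  have hg0 : 0 < g := lt_of_lt_of_le hx0 hxg
  obtain ⟨p, w, hp, hw, hp1, hpx, hw0, hD, hγp, hρ₀, hγpos⟩ := windowPair_coords x g T l a h hx1 hg0 ha hlow hcomp hlight
  obtain ⟨hlah, hDa, hgw, hden, hρ₁0, hρ₁x, h1γ₁, hdeep'⟩ :=
    windowPair_deep_gate₁ x g T p w l a h hx0 hx1 hxg hg1 hlow hcomp hlight hdeep hp hw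
  rw [hγp] at hγ
  have hx1ne : (1 - x) ≠ 0 := ne_of_gt (by linarith)
  have hg1ne : (1 - g) ≠ 0 := ne_of_gt (by linarith)
  have hxne : x ≠ 0 := ne_of_gt hx0
  set ρ₁ : ℝ := (T + (a : ℝ) * g - 2 * ((l : ℝ) + a)) / ((h : ℝ) - l - a) with hρ₁
  set γ₁ : ℝ := x ^ 2 + (1 - x) * ρ₁ with hγ₁
  have hγ₁x : γ₁ < x := by rw [hγ₁]; nlinarith [mul_lt_mul_of_pos_left hρ₁x (sub_pos.2 hx1)]
  have hγ₁0 : 0 ≤ γ₁ := by rw [hγ₁]; nlinarith [mul_nonneg (sub_nonneg.2 hx1.le) hρ₁0.le, sq_nonneg x]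
  have hw1 : p - 1 ≤ w := by
    have : x ≤ (T + (a : ℝ) * g - 2 * (l : ℝ)) / ((h : ℝ) - l) := by rw [le_div_iff₀ hD]; linarith
    linarith
  -- weights
  set lam₁ : ℝ := p * g * (g - w) / (p * g + w * (1 - x - g)) with hlam₁
  have hlam₁0 : 0 ≤ lam₁ := div_nonneg (mul_nonneg (mul_nonneg (by linarith) hg0.le) hgw.le) hden.le
  have hbal₁ : lam₁ * (1 - γ₁) = (1 - γ) * g := by
    rw [hlam₁, h1γ₁, hγ]; field_simp; ring
  have key := WindowPairCert.poly_DB x g p w hx0.le (by linarith) hg0.le (by linarith) (by linarith) (by linarith) (by linarith)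
    (by linarith) hw0.le (by linarith [hdeep']) (by linarith) (by linarith)
  have hsum : lam₁ + p * (1 - g) ≤ 1 := by
    rw [hlam₁, div_add' _ _ _ hden.ne', div_le_one hden]
    nlinarith [key]
  -- the transfer
  set s : ℝ := γ * g - (1 - γ) * (1 - g) * x / (1 - x) with hs
  have hs0 : 0 ≤ s := by
    rw [hs, sub_nonneg, div_le_iff₀ (by linarith : (0:ℝ) < 1 - x)]; linarith
  have hsle : s ≤ γ * g := by
    rw [hs, sub_le_self_iff]
    exact div_nonneg (mul_nonneg (mul_nonneg (by rw [hγ]; nlinarith) (by linarith)) hx0.le) (by linarith)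
  have hAx : (1 - γ) * (1 - g) * x / (1 - x) = p * (1 - g) * x := by
    rw [hγ]; field_simp; ring
  have hπ : 0 ≤ γ * (1 - g) + s - lam₁ * γ₁ := by
    rw [hs, hAx]; rw [hγ] at hbal₁ ⊢; nlinarith [hbal₁, hsum]
  have ht : s / (1 - g) * (1 - g) = s := div_mul_cancel₀ _ (by linarith)
  refine ⟨s / (1 - g), div_nonneg hs0 (by linarith), by rw [ht]; exact hsle, ?_⟩
  simp only [ht]
  refine windowPair_decAtT_of_weights x (T + (a : ℝ) * g) j' (M + a) l a h
    ((1 - γ) * (1 - g)) ((1 - γ) * g) (γ * (1 - g) + s) (γ * g - s)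
    γ₁ 0 0 lam₁ 0 0 ((1 - γ) * (1 - g) / (1 - x)) 0 (γ * (1 - g) + s - lam₁ * γ₁) 0
    hx0.le hx1.le ha (by exact_mod_cast (show (l : ℝ) < h by linarith)) hlaj hhj hjha (by omega) hmid
    ⟨hγ₁0, by linarith⟩ ⟨le_rfl, zero_le_one⟩ ⟨le_rfl, zero_le_one⟩ hlam₁0 le_rfl le_rfl
    (div_nonneg (mul_nonneg (by rw [hγ]; nlinarith) (by linarith)) (by linarith)) le_rfl hπ le_rfl
    ?_ ?_ ?_ ?_ ?_ ?_ ?_ ?_ ?_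
  · -- balance at l: the giant pair carries all of l
    rw [div_mul_cancel₀ _ hx1ne]; ring
  · linear_combination hbal₁
  · ring
  · -- balance at h + a
    rw [hs]; field_simp; ring
  · ring
  · intro _
    refine ⟨by exact_mod_cast hlah, ?_⟩
    rw [if_neg (not_le.2 hγ₁x)]
    have e : (γ₁ - x ^ 2) / (1 - x) = ρ₁ := by
      rw [hγ₁, add_sub_cancel_left, mul_div_cancel_left₀ _ (by linarith : (1 - x) ≠ 0)]
    rw [e, hρ₁]
    push_cast
    rw [show (h : ℝ) - ((l : ℝ) + a) = (h : ℝ) - l - a by ring, mul_div_cancel₀ _ hDa.ne']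
    linarith
  · intro h0; exact absurd h0 (lt_irrefl 0)
  · intro h0; exact absurd h0 (lt_irrefl 0)
  · intro h0; exact absurd h0 (lt_irrefl 0)

set_option maxHeartbeats 1600000 in
/-- **cell D-C** (deep, row-0 pair HEAVY and compatible `x(h−l) ≤ T + ag − 2l < h − l`, and the giant cannot take the row-0 low:
`γg(1−x) < (1−γ)(1−g)x`): `t = 0`; `l + a ↦ h` (light credit pair), the giant is filled by `γg(1−x)/x` of `l`, the rest
`q = (1−γ)(1−g) − γg(1−x)/x` of `l` goes into `h` through the heavy pair at gate `ρ₀`; the point weight left at `h` is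
`poly_DC/(x(1−ρ₀)(pg + w(1−x−g))) ≥ 0`. [this work] -/
theorem windowPair_deep_C (x g T γ : ℝ) (j' M l a h : ℕ) (hx0 : 0 < x) (hx1 : x < 1) (hxg : x ≤ g) (hg1 : g < 1) (ha : 1 ≤ a)
    (hlaj : l + a ≤ j') (hlow : 2 * (l : ℝ) < T) (hjha : j' + 1 ≤ h + a) (hhj : h ≤ j') (hhM : h ≤ M) (hcomp : T < (l : ℝ) + h)
    (hlight : T - 2 * (l : ℝ) < x * ((h : ℝ) - l)) (hmid : T + (a : ℝ) * g ≤ 2 * (h : ℝ))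
    (hγ : γ = x ^ 2 + (1 - x) * ((T - 2 * (l : ℝ)) / ((h : ℝ) - l)))
    (hdeep : 2 * ((l : ℝ) + a) < T + (a : ℝ) * g) (hheavy0 : x * ((h : ℝ) - l) ≤ T + (a : ℝ) * g - 2 * (l : ℝ))
    (hcompat0 : T + (a : ℝ) * g < (l : ℝ) + h) (hside : γ * g * (1 - x) < (1 - γ) * (1 - g) * x) :
    ∃ t : ℝ, 0 ≤ t ∧ t * (1 - g) ≤ γ * g ∧
      DECAtT x (T + (a : ℝ) * g) j' (M + a) (fun k => (1 - γ) * (1 - g) * (if k = l then (1 : ℝ) else 0)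
        + (1 - γ) * g * (if k = l + a then (1 : ℝ) else 0) + (γ * (1 - g) + t * (1 - g)) * (if k = h then (1 : ℝ) else 0)
        + (γ * g - t * (1 - g)) * (if k = h + a then (1 : ℝ) else 0)) := by
  have hg0 : 0 < g := lt_of_lt_of_le hx0 hxg
  obtain ⟨p, w, hp, hw, hp1, hpx, hw0, hD, hγp, hρ₀, hγpos⟩ := windowPair_coords x g T l a h hx1 hg0 ha hlow hcomp hlight
  obtain ⟨hlah, hDa, hgw, hden, hρ₁0, hρ₁x, h1γ₁, hdeep'⟩ :=
    windowPair_deep_gate₁ x g T p w l a h hx0 hx1 hxg hg1 hlow hcomp hlight hdeep hp hw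
  rw [hγp] at hγ
  have hx1ne : (1 - x) ≠ 0 := ne_of_gt (by linarith)
  have hg1ne : (1 - g) ≠ 0 := ne_of_gt (by linarith)
  have hxne : x ≠ 0 := ne_of_gt hx0
  set ρ₁ : ℝ := (T + (a : ℝ) * g - 2 * ((l : ℝ) + a)) / ((h : ℝ) - l - a) with hρ₁
  set γ₁ : ℝ := x ^ 2 + (1 - x) * ρ₁ with hγ₁
  have hγ₁x : γ₁ < x := by rw [hγ₁]; nlinarith [mul_lt_mul_of_pos_left hρ₁x (sub_pos.2 hx1)]
  have hγ₁0 : 0 ≤ γ₁ := by rw [hγ₁]; nlinarith [mul_nonneg (sub_nonneg.2 hx1.le) hρ₁0.le, sq_nonneg x]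
  -- the row-0 pair at T': heavy gate ρ₀ = 1 + x - p + w ∈ [x, 1)
  have hw1 : p - 1 ≤ w := by
    have : x ≤ (T + (a : ℝ) * g - 2 * (l : ℝ)) / ((h : ℝ) - l) := by rw [le_div_iff₀ hD]; linarith
    linarith
  have hw2 : w < p - x := by
    have : (T + (a : ℝ) * g - 2 * (l : ℝ)) / ((h : ℝ) - l) < 1 := by rw [div_lt_one hD]; linarith
    linarith
  have h1ρ₀ : 0 < p - x - w := by linarith
  -- weights
  set lam₁ : ℝ := p * g * (g - w) / (p * g + w * (1 - x - g)) with hlam₁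
  have hlam₁0 : 0 ≤ lam₁ := div_nonneg (mul_nonneg (mul_nonneg (by linarith) hg0.le) hgw.le) hden.le
  have hbal₁ : lam₁ * (1 - γ₁) = (1 - γ) * g := by
    rw [hlam₁, h1γ₁, hγ]; field_simp; ring
  -- q·x = (1−x)(p(x+g−2gx) − g) > 0 is the mass of l that does not fit into the giant
  have hqx : 0 < (1 - x) * (p * (x + g - 2 * g * x) - g) := by rw [hγ] at hside; nlinarith [hside]
  have hpos : 0 < x * (p - x - w) := mul_pos hx0 h1ρ₀
  set lam₀ : ℝ := (1 - x) * (p * (x + g - 2 * g * x) - g) / (x * (p - x - w)) with hlam₀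
  have hlam₀0 : 0 ≤ lam₀ := div_nonneg hqx.le hpos.le
  have key := WindowPairCert.poly_DC x g p w hx0.le (by linarith) hg0.le (by linarith) (by linarith) (by linarith) (by linarith)
    (by linarith) hw0.le (by linarith) (by linarith [hdeep']) (by linarith) (by linarith) (by linarith) (by nlinarith [hqx])
  -- the point weight at h: γ(1-g) - lam₁ γ₁ - lam₀ ρ₀ ≥ 0
  have hπ : 0 ≤ γ * (1 - g) + 0 - lam₁ * γ₁ - lam₀ * (1 + x - p + w) := by
    have e1 : lam₁ * γ₁ = lam₁ - (1 - γ) * g := by linarith [hbal₁]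
    have hfrac : p * g * (g - w) / (p * g + w * (1 - x - g))
        + (1 - x) * (p * (x + g - 2 * g * x) - g) * (1 + x - p + w) / (x * (p - x - w))
        ≤ γ * (1 - g) + (1 - γ) * g := by
      rw [div_add_div _ _ hden.ne' hpos.ne', div_le_iff₀ (mul_pos hden hpos), hγ]
      nlinarith [key]
    have e2 : lam₀ * (1 + x - p + w) = (1 - x) * (p * (x + g - 2 * g * x) - g) * (1 + x - p + w) / (x * (p - x - w)) := by
      rw [hlam₀]; ring
    rw [e1, e2, hlam₁]
    linarith [hfrac]
  refine ⟨0, le_rfl, by nlinarith [mul_nonneg (show 0 ≤ γ by rw [hγ]; nlinarith) hg0.le], ?_⟩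
  simp only [zero_mul, add_zero, sub_zero]
  refine windowPair_decAtT_of_weights x (T + (a : ℝ) * g) j' (M + a) l a h
    ((1 - γ) * (1 - g)) ((1 - γ) * g) (γ * (1 - g)) (γ * g)
    γ₁ 0 (1 + x - p + w) lam₁ 0 lam₀ (γ * g / x) 0 (γ * (1 - g) + 0 - lam₁ * γ₁ - lam₀ * (1 + x - p + w)) 0
    hx0.le hx1.le ha (by exact_mod_cast (show (l : ℝ) < h by linarith)) hlaj hhj hjha (by omega) hmid
    ⟨hγ₁0, by linarith⟩ ⟨le_rfl, zero_le_one⟩ ⟨by linarith, by linarith⟩ hlam₁0 le_rfl hlam₀0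
    (div_nonneg (mul_nonneg (by rw [hγ]; nlinarith) hg0.le) hx0.le) le_rfl hπ le_rfl
    ?_ ?_ ?_ ?_ ?_ ?_ ?_ ?_ ?_
  · -- balance at l: q into h, the rest into the giant
    rw [hlam₀, hγ]; field_simp; ring
  · linear_combination hbal₁
  · ring
  · rw [div_mul_cancel₀ _ hxne]; ring
  · ring
  · intro _
    refine ⟨by exact_mod_cast hlah, ?_⟩
    rw [if_neg (not_le.2 hγ₁x)]
    have e : (γ₁ - x ^ 2) / (1 - x) = ρ₁ := by
      rw [hγ₁, add_sub_cancel_left, mul_div_cancel_left₀ _ (by linarith : (1 - x) ≠ 0)]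
    rw [e, hρ₁]
    push_cast
    rw [show (h : ℝ) - ((l : ℝ) + a) = (h : ℝ) - l - a by ring, mul_div_cancel₀ _ hDa.ne']
    linarith
  · intro h0; exact absurd h0 (lt_irrefl 0)
  · -- validity of (l, h): heavy credit pair at gate ρ₀, credit exactly T'
    intro _
    rw [if_pos (by linarith : x ≤ 1 + x - p + w), ← hρ₀, mul_div_cancel₀ _ hD.ne']
    linarith
  · intro h0; exact absurd h0 (lt_irrefl 0)

end LawDec

end Quant

end Summit.CriticalPhenomena.PercolationContinuityZ3.Theorems
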